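import Summits.BirchSwinnertonDyer.BirchSwinnertonDyer.Theorems.CMKolyvaginAtInertTwoAnnihilatorAtTwoPow
import HarnessLib

/-!
# Route `CMKolyvaginAtInertTwo`, crux `CMKolyvaginExactAtInertTwo` (stmt-BirchSwinnertonDyer-24277):
# the ENTANGLED case of the `ε`-part at `p = 2`, level `2^M` — the explicit entanglement defect

Seat `bsd-line-cmk2-p1` g7 (cell `bsd-print-cf2`); helper (`--supports stmt-BirchSwinnertonDyer-24277`).
THEOREMS ONLY: no definition, no named fact, no `sorry`; no item is closed; BSD is not proved by this.

The annihilator file (p622318) bounds a Selmer class whose `ε`-part is DISENTANGLED from `δ(y_K)` at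
some depth `k`. This file supplies the disentanglement from ENTANGLEMENT DATA and so makes the defect
explicit (pure algebra + the coset form):

* `zsmul_sub_eq_zero_of_entangled` (algebra, any additive commutative group): if `2^m t = 2^b β' c`
  (`b ≤ m`) and `2^j t ∉ ℤc` for all `j < m` (minimality of `m`), then `t₁ = 2^{m−b} t − β' c` is
  disentangled from `c`: `α t₁ ∈ ℤc ⟹ α t₁ = 0` (the subgroup `{α : α t₁ ∈ ℤc}` contains `2^b`, is
  `2^{b'}ℤ` by Bézout, and `b' < b` would contradict minimality).
* `exists_two_pow_smul_eq_zsmul_of_entangled` — for `t ∈ Sel_{2^M}(E/K)` with `c_* t = ε t` and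
  entanglement data `(m, b, β')` as above w.r.t. `δ(y_K)`: **`2^{M−a+(m−b)}·t ∈ ℤ·δ(y_K)`** — the
  `ε`-part with the ENTANGLEMENT DEFECT `m − b` (`= 0` at odd `p`, where the eigenspaces are
  complementary; at `2` it measures the `2`-divisibility of `δy_K` inside `ℤt + ℤδy_K ⊆ Sel`).
* `exists_two_pow_smul_eq_zsmul_of_entangled_plus_part` — for ANY `s ∈ Sel_{2^M}(E/K)` with
  entanglement data for its `ε`-part `s + ε c_* s`: **`2^{M−a+(m−b)+1}·s ∈ ℤ·δ(y_K)`**.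

HONEST FRAMING. Together with p622318 this is everything single and double Kolyvagin primes give at
`2` inside `⟨s, δy_K⟩`: Kolyvagin's theorem at `2` as an ANNIHILATOR with exponent `M₀ + 2 + (m − b)`.
Whether a global argument over the finite group `Sel^ε` removes the defect is open; the `τ`-invariant
order-`2` classes and the crux's ORDER are untouched. Hypotheses at `2` not in print: ty2's data, `hcomm`.
References: [McCallumLMS1991] §1, §5; [GrossLMS1991] Props. 2.1, 2.3; memo + KERNEL-STATUS (v6).
-/

-- single-conjunct summit: `Summit.BirchSwinnertonDyer.BirchSwinnertonDyer.…` repeats the name by design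
set_option linter.dupNamespace false
set_option autoImplicit false

noncomputable section

open scoped Classical
open WeierstrassCurve NumberField IsDedekindDomain Field
open Literature.NumberTheory.GaloisRepresentations Literature.NumberTheory.EllipticCurves

namespace Summit.BirchSwinnertonDyer.BirchSwinnertonDyer.Theorems.KolyvaginDescentTwo

/-- **Disentangling by the minimal relation** (pure algebra): in an additive commutative group, if
`2^m t = (2^b β') c` with `b ≤ m` and `2^j t ∉ ℤ c` for every `j < m`, then for
`t₁ = 2^{m−b} t − β' c`: `α t₁ + γ c = 0 ⟹ α t₁ = 0`. [folklore] -/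
theorem zsmul_sub_eq_zero_of_entangled {G : Type*} [AddCommGroup G] {t c : G} {m b : ℕ} {β' : ℤ}
    (hbm : b ≤ m) (hrel : (((2 : ℕ) : ℤ) ^ m) • t = ((((2 : ℕ) : ℤ) ^ b) * β') • c)
    (hmin : ∀ (j : ℕ) (γ : ℤ), j < m → (((2 : ℕ) : ℤ) ^ j) • t ≠ γ • c) (α γ : ℤ)
    (h : α • ((((2 : ℕ) : ℤ) ^ (m - b)) • t - β' • c) + γ • c = 0) :
    α • ((((2 : ℕ) : ℤ) ^ (m - b)) • t - β' • c) = 0 := by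
  set t₁ := (((2 : ℕ) : ℤ) ^ (m - b)) • t - β' • c with ht₁
  -- (F1) `2^b t₁ = 0`
  have hF1 : (((2 : ℕ) : ℤ) ^ b) • t₁ = 0 := by
    rw [ht₁, zsmul_sub, smul_smul, ← pow_add, show b + (m - b) = m by omega, hrel, smul_smul, sub_self]
  -- (F2) every `δ` with `δ t₁ ∈ ℤc` and `δ ∣ 2^b`, `δ = 2^{b'}`, has `b' = b`
  -- Bézout: `g = gcd(α, 2^b) = x α + y 2^b`, so `g t₁ ∈ ℤ c`
  set g : ℕ := Int.gcd α (((2 : ℕ) : ℤ) ^ b) with hg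
  have hgdvd : (g : ℤ) ∣ (((2 : ℕ) : ℤ) ^ b) := Int.gcd_dvd_right _ _
  have hgdvdα : (g : ℤ) ∣ α := Int.gcd_dvd_left _ _
  have hgnat : g ∣ 2 ^ b := by
    have h1 : (g : ℤ) ∣ ((2 ^ b : ℕ) : ℤ) := by rw [Nat.cast_pow]; exact hgdvd
    exact_mod_cast h1
  obtain ⟨b', hb'le, hgb'⟩ := (Nat.dvd_prime_pow Nat.prime_two).mp hgnat
  have hαt₁ : α • t₁ = (-γ) • c := by rw [neg_zsmul, ← sub_eq_zero, sub_neg_eq_add, h]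
  have hgt₁ : ∃ γ' : ℤ, (g : ℤ) • t₁ = γ' • c := by
    refine ⟨Int.gcdA α (((2 : ℕ) : ℤ) ^ b) * (-γ), ?_⟩
    rw [hg, Int.gcd_eq_gcd_ab α (((2 : ℕ) : ℤ) ^ b), add_zsmul, mul_comm _ (Int.gcdA _ _), mul_zsmul,
      hαt₁, mul_comm _ (Int.gcdB _ _), mul_zsmul, hF1, zsmul_zero, add_zero, ← mul_zsmul]
  -- `b' = b`, else minimality fails at `j = b' + (m - b) < m`
  have hb' : b' = b := by
    by_contra hne
    have hlt : b' < b := lt_of_le_of_ne hb'le hne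
    obtain ⟨γ', hγ'⟩ := hgt₁
    rw [hgb', Nat.cast_pow, ht₁, zsmul_sub, smul_smul, ← pow_add, smul_smul, sub_eq_iff_eq_add,
      ← add_zsmul] at hγ'
    exact hmin (b' + (m - b)) _ (by omega) hγ'
  -- so `2^b ∣ α` and `α t₁ = (α / 2^b) (2^b t₁) = 0`
  rw [hb'] at hgb'
  have h2bα : (((2 : ℕ) : ℤ) ^ b) ∣ α := by
    have : (g : ℤ) = ((2 : ℕ) : ℤ) ^ b := by rw [hgb']; push_cast; ring
    rw [← this]; exact hgdvdα
  obtain ⟨α', hα'⟩ := h2bα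
  rw [hα', mul_comm, mul_zsmul, hF1, zsmul_zero]

variable (W : WeierstrassCurve ℚ) {K : Type} [Field K] [NumberField K]

/-- **The `ε`-part with its entanglement defect**: for `t ∈ Sel_{2^M}(E/K)` with `c_* t = ε t` and
entanglement data `2^m t = 2^b β' δ(y_K)` (`b ≤ m`), `2^j t ∉ ℤδ(y_K)` for `j < m`:
`2^{M−a+(m−b)}·t = r·δ(y_K)` for some `r ∈ ℤ` (coset form of the two-prime step applied to
`2^{m−b} t − β' δy_K`, disentangled by `zsmul_sub_eq_zero_of_entangled`).
[cite: McCallumLMS1991, §5 Lemma 5.1, Thm. 5.4] [cite: GrossLMS1991, Prop. 2.3] -/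
theorem exists_two_pow_smul_eq_zsmul_of_entangled {N : ℕ} [NeZero N]
    [W.IsElliptic] (hK : IsImaginaryQuadratic K) {P : (W.baseChange K).toAffine.Point}
    (hP : IsHeegnerPoint N W K P) (hnt : ¬ IsOfFinAddOrder P)
    (hρ : W.HasSurjectiveModNGaloisRep 2) (hΔ : W.Δ < 0) (hΔK : ¬ IsSquare (W.baseChange K).Δ)
    {c : K ≃ₐ[ℚ] K} (hc : c ≠ 1) {M : ℕ} (hM : 1 ≤ M) {z : absoluteGaloisGroup K}
    (hzfix : ∀ T : geomTorsion (W.baseChange K) ((2 : ℕ) : ℤ), z • T = T → T = 0)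
    (hcomm : ∀ π ∈ torsionFixing (W.baseChange K) ((2 : ℕ) : ℤ),
      ∀ T : geomTorsion (W.baseChange K) ((2 ^ M : ℕ) : ℤ), π • z • T = z • π • T)
    {a : ℕ} (ha : a < M)
    (hy : ∀ Q : (W.baseChange K).toAffine.Point, ((2 ^ M : ℕ) : ℤ) • Q ≠ ((((2 : ℕ) : ℤ) ^ a)) • P)
    {ε : ℤ} (hε : ε = 1 ∨ ε = -1)
    (hPε : IsOfFinAddOrder (Affine.Point.map (W' := W) (c : K →ₐ[ℚ] K) P - ε • P))
    (D : Rank1Residual.P2.KolyvaginMachine.PointSystemFamily N W K P 2 fun _ ↦ True)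
    (R : Rank1Residual.P2.KolyvaginMachine.ReciprocityFamily N W K 2 fun _ ↦ True)
    (hdiv : ∀ Q : geomPoints (W.baseChange K), ∃ R, ((2 ^ M : ℕ) : ℤ) • R = Q)
    {t : galH1Torsion (W.baseChange K) ((2 ^ M : ℕ) : ℤ)}
    (ht : t ∈ selmerGroup (W.baseChange K) ((2 ^ M : ℕ) : ℤ))
    (htε : conjAct W c ((2 ^ M : ℕ) : ℤ) t = ε • t) {m b : ℕ} {β' : ℤ} (hbm : b ≤ m)
    (hrel : (((2 : ℕ) : ℤ) ^ m) • t =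
      ((((2 : ℕ) : ℤ) ^ b) * β') • kummerMapTorsion (W.baseChange K) _ hdiv P)
    (hmin : ∀ (j : ℕ) (γ : ℤ), j < m →
      (((2 : ℕ) : ℤ) ^ j) • t ≠ γ • kummerMapTorsion (W.baseChange K) _ hdiv P) :
    ∃ r : ℤ, (((2 : ℕ) : ℤ) ^ (M - a + (m - b))) • t =
      r • kummerMapTorsion (W.baseChange K) _ hdiv P :=
  exists_two_pow_smul_eq_zsmul_of_coset_indep W hK hP hnt hρ hΔ hΔK hc hM hzfix hcomm ha hy hε hPε D R
    hdiv ht htε (m - b) β' (fun α γ h ↦ zsmul_sub_eq_zero_of_entangled hbm hrel hmin α γ h)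

/-- **The annihilator with the entanglement defect, for an arbitrary Selmer class**: for
`s ∈ Sel_{2^M}(E/K)` with entanglement data `(m, b, β')` for its `ε`-part `s⁺ = s + ε c_* s` w.r.t.
`δ(y_K)`: `2^{M−a+(m−b)+1}·s = r·δ(y_K)` for some `r ∈ ℤ`.
[cite: McCallumLMS1991, §1 Theorem (Kolyvagin), §5] [cite: GrossLMS1991, Thm. 1.3, Props. 2.1, 2.3] -/
theorem exists_two_pow_smul_eq_zsmul_of_entangled_plus_part {N : ℕ} [NeZero N]
    [W.IsElliptic] (hK : IsImaginaryQuadratic K) {P : (W.baseChange K).toAffine.Point}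
    (hP : IsHeegnerPoint N W K P) (hnt : ¬ IsOfFinAddOrder P)
    (hρ : W.HasSurjectiveModNGaloisRep 2) (hΔ : W.Δ < 0) (hΔK : ¬ IsSquare (W.baseChange K).Δ)
    {c : K ≃ₐ[ℚ] K} (hc : c ≠ 1) {M : ℕ} (hM : 1 ≤ M) {z : absoluteGaloisGroup K}
    (hzfix : ∀ T : geomTorsion (W.baseChange K) ((2 : ℕ) : ℤ), z • T = T → T = 0)
    (hcomm : ∀ π ∈ torsionFixing (W.baseChange K) ((2 : ℕ) : ℤ),
      ∀ T : geomTorsion (W.baseChange K) ((2 ^ M : ℕ) : ℤ), π • z • T = z • π • T)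
    {a : ℕ} (ha : a < M)
    (hy : ∀ Q : (W.baseChange K).toAffine.Point, ((2 ^ M : ℕ) : ℤ) • Q ≠ ((((2 : ℕ) : ℤ) ^ a)) • P)
    {ε : ℤ} (hε : ε = 1 ∨ ε = -1)
    (hPε : IsOfFinAddOrder (Affine.Point.map (W' := W) (c : K →ₐ[ℚ] K) P - ε • P))
    (D : Rank1Residual.P2.KolyvaginMachine.PointSystemFamily N W K P 2 fun _ ↦ True)
    (R : Rank1Residual.P2.KolyvaginMachine.ReciprocityFamily N W K 2 fun _ ↦ True)
    (hdiv : ∀ Q : geomPoints (W.baseChange K), ∃ R, ((2 ^ M : ℕ) : ℤ) • R = Q)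
    {s : galH1Torsion (W.baseChange K) ((2 ^ M : ℕ) : ℤ)}
    (hs : s ∈ selmerGroup (W.baseChange K) ((2 ^ M : ℕ) : ℤ)) {m b : ℕ} {β' : ℤ} (hbm : b ≤ m)
    (hrel : (((2 : ℕ) : ℤ) ^ m) • (s + ε • conjAct W c ((2 ^ M : ℕ) : ℤ) s) =
      ((((2 : ℕ) : ℤ) ^ b) * β') • kummerMapTorsion (W.baseChange K) _ hdiv P)
    (hmin : ∀ (j : ℕ) (γ : ℤ), j < m →
      (((2 : ℕ) : ℤ) ^ j) • (s + ε • conjAct W c ((2 ^ M : ℕ) : ℤ) s) ≠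
        γ • kummerMapTorsion (W.baseChange K) _ hdiv P) :
    ∃ r : ℤ, (((2 : ℕ) : ℤ) ^ (M - a + (m - b) + 1)) • s =
      r • kummerMapTorsion (W.baseChange K) _ hdiv P :=
  exists_two_pow_smul_eq_zsmul_of_families_two_pow W hK hP hnt hρ hΔ hΔK hc hM hzfix hcomm ha hy hε hPε D
    R hdiv hs (m - b) β' (fun α γ h ↦ zsmul_sub_eq_zero_of_entangled hbm hrel hmin α γ h)

end Summit.BirchSwinnertonDyer.BirchSwinnertonDyer.Theorems.KolyvaginDescentTwo

end
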